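import Summits.BirchSwinnertonDyer.BirchSwinnertonDyer.Theorems.ByReductionTypeAtTwoMultTowerSplitExactOddCount
import Summits.BirchSwinnertonDyer.BirchSwinnertonDyer.Theorems.ByReductionTypeAtTwoMultTowerSplitExactTwo
import Literature.NumberTheory.EllipticCurves.Greenberg1999.ControlLocalKernelAtPMultiplicative
import HarnessLib

/-!
# Route `ByReductionTypeAtTwo`, crux `MultUpperHalfAtTwo` (item stmt-BirchSwinnertonDyer-19922), TOWER road, SPLIT rows:
# the EXACT order of the local tower kernel at a split multiplicative prime, part 11 — ODD `p` assembled and the `∀ p`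
# named fact `Greenberg1999.sec3_natCard_localTowerKerPrimary_splitMultiplicative_rat` DISCHARGED

HONEST FRAMING (cell `bsd-2adic`, run/shared/lean/pub/bsd-2adic/, seat `bsd-2adic-tower-1` GEN 27, HUMAN RULINGS
D-0036 / D-0054 / D-0074): theorems only (no definition, no `sorry`); the last declaration's TYPE is the PRINT named fact
`hSP = Literature.NumberTheory.EllipticCurves.Greenberg1999.sec3_natCard_localTowerKerPrimary_splitMultiplicative_rat`
(Greenberg, LNM 1716 §3 pp. 90–93 over the tower of `ℚ`: `#ker(r_{v_n}) = p^{ord_p(log_p q_E) − ord_p(2p)}` at a split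
multiplicative `p`, every layer), so the gate records it as DISCHARGED — the ~600 consumer files keep their `(hSP : …)`
binder but the fact is now a theorem of the tree. Nothing booked under D-0054; BSD is not proved by any of this; the
consumers' other binders (`hEC`, `h414`, …) are untouched.

* `exists_eq_prime_pow_mul_units_of_norm_lt_one` — `ℚ_pˣ ∩ {‖x‖ < 1} ⊆ p^ℕ · ℤ_pˣ`;
* `finite_and_natCard_localTowerKerPrimary_le_pow_splitOdd` — **UPPER bound** `#𝒦_{v,n}[p^∞] ≤ p^w` for odd `p` with
  `ord_p(log_p q_E) = w + 1`: uniformise at `v` (BRICK S3), depth `‖1 − u^{p−1}‖ = p^{−(w+1)}` (part 8), the count (part 10)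
  and `𝒦_{v,n}[p^∞] ↪ (M_∞/(g−1)M_∞)[p^∞]` (`finite_localTowerKerPrimary_and_card_le`);
* `pow_le_natCard_localTowerKerPrimary_splitOdd` — **LOWER bound** `p^w ≤ #𝒦_{v,n}[p^∞]`: `q_E^{p^n} = p^{kp^n} u^{p^n}` with
  `(u^{p^n})^{p−1} ≡ 1 (mod p^{n+w+1})` lies in `N(F_{n+w}ˣ)` (part 7), the transfer (part 2) gives `x ∈ F_{n+w}` with
  `N_{F_{n+w}/F_n}(x) = q_E`, whose class has order exactly `p^w` (part 1);
* `finite_and_natCard_localTowerKerPrimary_eq_pow_splitOdd`, `sec3_natCard_localTowerKerPrimary_splitMultiplicative_odd` —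
  the odd-`p` clause (`ord_p(2p) = 1`);
* `sec3_natCard_localTowerKerPrimary_splitMultiplicative_rat_holds` — **the named fact, all `p`** (`p = 2`: part 3).

References: R. Greenberg, LNM 1716 §3 (PDF pp. 90–93); J. Silverman, *Advanced Topics*, Thm. V.3.1, V.5.3; J. Neukirch,
*Algebraic Number Theory*, Ch. IV (3.5), Ch. V §1 (1.1); L. Washington, *Cyclotomic Fields* §13.1; K. Iwasawa, *Lectures on
p-adic L-functions* §4.4; cell memo NOTE-HNS2-KERNEL-GEN27.md.
-/

set_option autoImplicit false
-- the Theorems namespace of this sub repeats the summit name by design (D-0017 nested layout: Summit.<S>.<Sub>)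
set_option linter.dupNamespace false

noncomputable section

open scoped Classical IntermediateField

namespace Summit.BirchSwinnertonDyer.BirchSwinnertonDyer.Theorems.MultTowerSplitExact

open NumberField IsDedekindDomain Field WeierstrassCurve PadicInt Rat.HeightOneSpectrum
  Literature.NumberTheory.EllipticCurves Literature.NumberTheory.EllipticCurves.ResKernel
  Literature.NumberTheory.GaloisRepresentations
  Summit.BirchSwinnertonDyer.BirchSwinnertonDyer.Theorems.MultTowerNS2
  Summit.BirchSwinnertonDyer.BirchSwinnertonDyer.Theorems.MultTowerSplitOrder

variable {p : ℕ} [hp : Fact p.Prime]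

/-- `ℚ_pˣ ∩ {‖x‖ < 1} ⊆ p^ℕ · ℤ_pˣ`: a non-zero `x ∈ ℚ_p` with `‖x‖ < 1` is `p^k · u`, `k ∈ ℕ`, `u` a unit. The `p`-general form
of GEN 13's `exists_eq_two_pow_mul_units`. [folklore] -/
theorem exists_eq_prime_pow_mul_units_of_norm_lt_one {x : ℚ_[p]} (hx0 : x ≠ 0) (hx : ‖x‖ < 1) :
    ∃ (k : ℕ) (u : ℤ_[p]ˣ), x = (p : ℚ_[p]) ^ k * ((u : ℤ_[p]) : ℚ_[p]) := by
  obtain ⟨j, u, hju⟩ := exists_eq_prime_zpow_mul_units x hx0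
  have hp1 : (1 : ℝ) < p := by exact_mod_cast hp.out.one_lt
  have hj : 0 ≤ j := by
    by_contra hneg
    push Not at hneg
    have hn : ‖x‖ = (p : ℝ) ^ (-j) := by
      rw [hju, norm_mul, Padic.norm_p_zpow, show ‖((u : ℤ_[p]) : ℚ_[p])‖ = 1 from PadicInt.norm_units u, mul_one]
    have : (1 : ℝ) ≤ (p : ℝ) ^ (-j) := one_le_zpow₀ hp1.le (by omega)
    linarith
  refine ⟨j.toNat, u, ?_⟩
  rw [hju, ← zpow_natCast, Int.toNat_of_nonneg hj]

variable {κ : ZpExtension ℚ p}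

/-! ### The odd-`p` kernel theorems -/

/-- **UPPER bound at a split multiplicative ODD `p`: `#𝒦_{v,n}[p^∞] ≤ p^w`** for `W/ℚ` elliptic with a Tate datum `Dq` at
`p`, `log_p q_E ≠ 0`, `ord_p(log_p q_E) = w + 1`, every cyclotomic `κ`, `v ∋ p`, every layer `n` (uniformisation BRICK S3,
depth part 8, count part 10, `𝒦_{v,n}[p^∞] ↪ (M_∞/(g−1)M_∞)[p^∞]`). The odd-`p` form of GEN 13's
`finite_and_natCard_localTowerKerPrimary_le_pow_splitTwo`. [cite: GreenbergLNM1716, §3, between Prop. 3.6 and Prop. 3.7 (PDF pp. 92–93)]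
[cite: SilvermanATAEC1994, Thm. V.3.1, V.5.3] [cite: NeukirchANT1999, Ch. IV (3.5)] -/
theorem finite_and_natCard_localTowerKerPrimary_le_pow_splitOdd (hp2 : p ≠ 2) (W : WeierstrassCurve ℚ) [W.IsElliptic]
    (Dq : TateParameterData W p) (hlog : padicLog p Dq.q ≠ 0) {w : ℕ}
    (hw : (padicLog p Dq.q).valuation = (w : ℤ) + 1) (κ : ZpExtension ℚ p) (hκ : κ.IsCyclotomic)
    (v : HeightOneSpectrum (𝓞 ℚ)) (hv : ((p : ℕ) : 𝓞 ℚ) ∈ v.asIdeal) (n : ℕ) :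
    Finite (W.localTowerKerPrimary κ (v.adicCompletion ℚ) n) ∧
      Nat.card (W.localTowerKerPrimary κ (v.adicCompletion ℚ) n) ≤ p ^ w := by
  -- the uniformisation at `v` and the identification with `Dq.q`
  have hsplitv := hasSplitMultiplicativeReductionAt_of_atPrime W v hv Dq.split
  obtain ⟨q, Φ, hq0, hq1, hqj, hsurj, hker, hequiv⟩ := exists_tateUniformisation_tateJ W v hsplitv
  obtain ⟨e, he⟩ := exists_ringEquiv_tateParameter p v hv
  have heq : e q = Dq.q := he W q hq0 hq1 hqj Dq
  -- `Dq.q = p^k' u`, `u` of depth `w + 1`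
  obtain ⟨k', u, hqu⟩ := exists_eq_prime_pow_mul_units_of_norm_lt_one Dq.q_ne_zero Dq.norm_q_lt_one
  obtain ⟨d, -, hd, hval⟩ := exists_depth_of_padicLog_odd hp2 hqu hlog
  have hdw : (d : ℤ) = (w : ℤ) + 1 := by rw [← hval, hw]
  have hd' : ‖1 - ((u : ℤ_[p]) : ℚ_[p]) ^ (p - 1)‖ = (p : ℝ) ^ (-((w : ℤ) + 1)) := by rw [hd, hdw]
  have hq : e q = (p : ℚ_[p]) ^ k' * ((u : ℤ_[p]) : ℚ_[p]) := by rw [heq, hqu]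
  -- equivariance in value form
  have hequiv' : ∀ (σ : absoluteGaloisGroup (v.adicCompletion ℚ)) (w w' : (AlgebraicClosure (v.adicCompletion ℚ))ˣ),
      (w' : AlgebraicClosure (v.adicCompletion ℚ)) = σ • (w : AlgebraicClosure (v.adicCompletion ℚ)) →
        σ • Φ (Additive.ofMul w) = Φ (Additive.ofMul w') := by
    intro σ w w' h
    have hw' : w' = Units.map (absoluteGaloisGroup.toAlgEquiv (v.adicCompletion ℚ) σ :
        AlgebraicClosure (v.adicCompletion ℚ) →* AlgebraicClosure (v.adicCompletion ℚ)) w := Units.ext h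
    rw [hw']
    exact hequiv σ w
  -- a topological generator and the count
  obtain ⟨g, hgn, hgen⟩ := ZpExtension.exists_mem_localSubgroup_generate κ (v.adicCompletion ℚ) n
  obtain ⟨hfinT, hcardT⟩ := finite_primaryComponent_coinvariants_and_card_le_odd hp2 hκ v hv hsurj hker hequiv' hq0 hq1
    e hq hd' n hgn hgen
  haveI := hfinT
  obtain ⟨hfin, hcard⟩ := finite_localTowerKerPrimary_and_card_le W κ (v.adicCompletion ℚ) n hgn hgen
  exact ⟨hfin, hcard.trans hcardT⟩

/-- **LOWER bound at a split multiplicative ODD `p`: `p^w ≤ #𝒦_{v,n}[p^∞]`** with `ord_p(log_p q_E) = w + 1` (every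
cyclotomic `κ`, `v ∋ p`, every layer `n`): uniformise (BRICK S3), read `q_E = p^k u` with `‖1 − u^{p−1}‖ = p^{−(w+1)}`; then
`q_E^{p^n} = p^{kp^n} · u^{p^n}` with `(u^{p^n})^{p−1} ≡ 1 (mod p^{n+w+1})` lies in `N(F_{n+w}ˣ)` (part 7); the transfer (part 2)
gives `x ∈ F_{n+w}` with `N_{F_{n+w}/F_n}(x) = q_E`, whose class has order exactly `p^w` (part 1). The odd-`p` form of part 3's
`pow_le_natCard_localTowerKerPrimary_splitTwo`. [cite: GreenbergLNM1716, §3, between Prop. 3.6 and Prop. 3.7 (PDF pp. 92–93)]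
[cite: SilvermanATAEC1994, Thm. V.3.1, V.5.3] [cite: NeukirchANT1999, Ch. IV (3.5) and Ch. V §1 Thm. (1.1)] -/
theorem pow_le_natCard_localTowerKerPrimary_splitOdd (hp2 : p ≠ 2) (W : WeierstrassCurve ℚ) [W.IsElliptic]
    (Dq : TateParameterData W p) (hlog : padicLog p Dq.q ≠ 0) {w : ℕ}
    (hw : (padicLog p Dq.q).valuation = (w : ℤ) + 1) (κ : ZpExtension ℚ p) (hκ : κ.IsCyclotomic)
    (v : HeightOneSpectrum (𝓞 ℚ)) (hv : ((p : ℕ) : 𝓞 ℚ) ∈ v.asIdeal) (n : ℕ) :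
    p ^ w ≤ Nat.card (W.localTowerKerPrimary κ (v.adicCompletion ℚ) n) := by
  -- the uniformisation at `v` and the identification with `Dq.q`
  have hsplitv := hasSplitMultiplicativeReductionAt_of_atPrime W v hv Dq.split
  obtain ⟨q, Φ, hq0, hq1, hqj, hsurj, hker, hequiv⟩ := exists_tateUniformisation_tateJ W v hsplitv
  obtain ⟨e, he⟩ := exists_ringEquiv_tateParameter p v hv
  have heq : e q = Dq.q := he W q hq0 hq1 hqj Dq
  obtain ⟨k', u, hqu⟩ := exists_eq_prime_pow_mul_units_of_norm_lt_one Dq.q_ne_zero Dq.norm_q_lt_one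
  obtain ⟨d, -, hd, hval⟩ := exists_depth_of_padicLog_odd hp2 hqu hlog
  have hdw : (d : ℤ) = (w : ℤ) + 1 := by rw [← hval, hw]
  have hd' : ‖1 - ((u : ℤ_[p]) : ℚ_[p]) ^ (p - 1)‖ = (p : ℝ) ^ (-((w : ℤ) + 1)) := by rw [hd, hdw]
  have hq : e q = (p : ℚ_[p]) ^ k' * ((u : ℤ_[p]) : ℚ_[p]) := by rw [heq, hqu]
  -- equivariance in value form
  have hequiv' : ∀ (σ : absoluteGaloisGroup (v.adicCompletion ℚ)) (w₁ w' : (AlgebraicClosure (v.adicCompletion ℚ))ˣ),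
      (w' : AlgebraicClosure (v.adicCompletion ℚ)) = σ • (w₁ : AlgebraicClosure (v.adicCompletion ℚ)) →
        σ • Φ (Additive.ofMul w₁) = Φ (Additive.ofMul w') := by
    intro σ w₁ w' h
    have hw' : w' = Units.map (absoluteGaloisGroup.toAlgEquiv (v.adicCompletion ℚ) σ :
        AlgebraicClosure (v.adicCompletion ℚ) →* AlgebraicClosure (v.adicCompletion ℚ)) w₁ := Units.ext h
    rw [hw']
    exact hequiv σ w₁
  -- the Tate parameter in `K̄_v`
  set Q : AlgebraicClosure (v.adicCompletion ℚ) := algebraMap (v.adicCompletion ℚ) (AlgebraicClosure (v.adicCompletion ℚ)) q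
    with hQ
  have hQ0 : Q ≠ 0 := by rw [hQ]; exact (map_ne_zero _).mpr hq0
  have hQfix : ∀ σ : absoluteGaloisGroup (v.adicCompletion ℚ), σ • Q = Q := fun σ ↦
    AlgEquiv.commutes (absoluteGaloisGroup.toAlgEquiv _ σ) q
  have hQtor : ∀ j : ℤ, Q ^ j = 1 → j = 0 := by
    intro j hj
    have hj' : q ^ j = 1 := by
      apply (algebraMap (v.adicCompletion ℚ) (AlgebraicClosure (v.adicCompletion ℚ))).injective
      rw [map_zpow₀, map_one]; exact hj
    have hpow : ∀ m : ℕ, q ^ m = 1 → m = 0 := fun m hm ↦ by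
      by_contra hm0
      have h1 : ‖q‖ ^ m < 1 := pow_lt_one₀ (norm_nonneg q) hq1 hm0
      rw [← norm_pow, hm, norm_one] at h1
      exact lt_irrefl _ h1
    cases j with
    | ofNat m =>
      rw [Int.ofNat_eq_natCast, zpow_natCast] at hj'
      rw [Int.ofNat_eq_natCast, hpow m hj']
      rfl
    | negSucc m =>
      rw [zpow_negSucc, inv_eq_one] at hj'
      exact absurd (hpow (m + 1) hj') (Nat.succ_ne_zero m)
  -- a topological generator
  obtain ⟨g, hgn, hgen⟩ := ZpExtension.exists_mem_localSubgroup_generate κ (v.adicCompletion ℚ) n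
  obtain ⟨ug, hug⟩ := MultTowerSP1.exists_units_kappa_resGal_eq_of_generate hκ v hv n hgn hgen
  -- finiteness of the `p`-primary coinvariants (part 10)
  obtain ⟨hfinT, -⟩ := finite_primaryComponent_coinvariants_and_card_le_odd hp2 hκ v hv hsurj hker hequiv' hq0 hq1 e hq
    hd' n hgn hgen
  haveI := hfinT
  -- `q^{p^n} ∈ N(F_{n+w}ˣ)` (part 7): unit part `u^{p^n}` with `(u^{p^n})^{p-1} ≡ 1 (mod p^{n+w+1})`
  have hp0' : (0 : ℝ) < p := by exact_mod_cast hp.out.pos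
  have hu1 : ‖((u : ℤ_[p]) : ℚ_[p])‖ = 1 := PadicInt.norm_units u
  have hy : ‖1 - ((u : ℤ_[p]) : ℚ_[p]) ^ (p - 1)‖ < 1 := norm_one_sub_pow_sub_one_lt hu1
  have hcong : toZModPow (n + w + 1) ((((u ^ p ^ n : ℤ_[p]ˣ) : ℤ_[p])) ^ (p - 1)) = 1 := by
    rw [toZModPow_eq_one_iff_norm_sub_one_le, PadicInt.norm_def, PadicInt.coe_sub, PadicInt.coe_pow, Units.val_pow_eq_pow_val,
      PadicInt.coe_pow, PadicInt.coe_one, ← pow_mul, mul_comm (p ^ n) (p - 1), pow_mul, norm_sub_rev,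
      norm_one_sub_pow_eq hp2 hy, hd', Nat.cast_pow, Padic.norm_p_pow, ← zpow_add₀ hp0'.ne']
    apply le_of_eq
    congr 1
    push_cast
    ring
  set qu : (v.adicCompletion ℚ)ˣ := Units.mk0 q hq0 with hqu_def
  have hmem : qu ^ p ^ n ∈ (Units.map (Algebra.norm (v.adicCompletion ℚ) :
      IntermediateField.fixedField (localSubgroup (κ.layerSubgroup (n + w)) (v.adicCompletion ℚ)) →*
        v.adicCompletion ℚ)).range := by
    rw [mem_range_norm_fixedField_layer_iff_odd hp2 hκ v hv (n + w) e]
    refine ⟨((k' * p ^ n : ℕ) : ℤ), u ^ p ^ n, hcong, ?_⟩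
    rw [hqu_def, Units.val_pow_eq_pow_val, Units.val_mk0, map_pow, hq, mul_pow, ← pow_mul, zpow_natCast,
      Units.val_pow_eq_pow_val, PadicInt.coe_pow]
  obtain ⟨x, hxw, hNx⟩ := exists_prod_smul_eq_of_pow_mem_range_norm hκ v hv n w hgn hug qu hmem
  rw [hqu_def, Units.val_mk0] at hNx
  exact pow_le_natCard_localTowerKerPrimary_of_prod_smul_eq hκ v hv W hsurj hker hequiv' hQfix hQ0 hQtor n hgn hgen w
    hxw hNx

/-- **`#𝒦_{v,n}[p^∞] = p^w` EXACTLY at a split multiplicative odd `p` with `ord_p(log_p q_E) = w + 1`, every layer**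
(Greenberg's `|ker(r_{v_n})| ∼ log_p(q_E)/(2p)` over the tower of `ℚ`, LNM 1716 p. 93, KERNEL).
[cite: GreenbergLNM1716, §3, between Prop. 3.6 and Prop. 3.7 (PDF pp. 92–93)] -/
theorem finite_and_natCard_localTowerKerPrimary_eq_pow_splitOdd (hp2 : p ≠ 2) (W : WeierstrassCurve ℚ) [W.IsElliptic]
    (Dq : TateParameterData W p) (hlog : padicLog p Dq.q ≠ 0) {w : ℕ}
    (hw : (padicLog p Dq.q).valuation = (w : ℤ) + 1) (κ : ZpExtension ℚ p) (hκ : κ.IsCyclotomic)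
    (v : HeightOneSpectrum (𝓞 ℚ)) (hv : ((p : ℕ) : 𝓞 ℚ) ∈ v.asIdeal) (n : ℕ) :
    Finite (W.localTowerKerPrimary κ (v.adicCompletion ℚ) n) ∧
      Nat.card (W.localTowerKerPrimary κ (v.adicCompletion ℚ) n) = p ^ w := by
  obtain ⟨hfin, hle⟩ := finite_and_natCard_localTowerKerPrimary_le_pow_splitOdd hp2 W Dq hlog hw κ hκ v hv n
  exact ⟨hfin, le_antisymm hle (pow_le_natCard_localTowerKerPrimary_splitOdd hp2 W Dq hlog hw κ hκ v hv n)⟩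

/-- **The odd-`p` clause of the named fact `Greenberg1999.sec3_natCard_localTowerKerPrimary_splitMultiplicative_rat`, body
verbatim**: for odd `p`, `W/ℚ` with a Tate parameter datum `Dq` at `p` and `log_p q_E ≠ 0`, the cyclotomic `κ` and `v ∋ p`,
there is `e` with `e + ord_p(2p) = ord_p(log_p q_E)` (`ord_p(2p) = 1`, `ord_p(log_p q_E) ≥ 1`) such that at EVERY layer
`𝒦_{v,n}[p^∞]` is finite of order `p^e`. [cite: GreenbergLNM1716, §3, between Prop. 3.6 and Prop. 3.7 (PDF pp. 90–93)]
[cite: Washington1997, §13.1] -/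
theorem sec3_natCard_localTowerKerPrimary_splitMultiplicative_odd (hp2 : p ≠ 2) (W : WeierstrassCurve ℚ) [W.IsElliptic]
    (Dq : TateParameterData W p) (hlog : padicLog p Dq.q ≠ 0)
    (κ : ZpExtension ℚ p) (hκ : κ.IsCyclotomic) (v : HeightOneSpectrum (𝓞 ℚ)) (hv : ((p : ℕ) : 𝓞 ℚ) ∈ v.asIdeal) :
    ∃ e : ℕ, (e : ℤ) + (padicValNat p (2 * p) : ℤ) = (padicLog p Dq.q).valuation ∧
      ∀ n : ℕ, Finite (W.localTowerKerPrimary κ (v.adicCompletion ℚ) n) ∧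
        Nat.card (W.localTowerKerPrimary κ (v.adicCompletion ℚ) n) = p ^ e := by
  have h2p : padicValNat p (2 * p) = 1 := by
    have hnd : ¬ p ∣ 2 := fun h ↦ hp2 ((Nat.prime_dvd_prime_iff_eq hp.out Nat.prime_two).mp h)
    rw [padicValNat.mul (by norm_num) hp.out.ne_zero, padicValNat.eq_zero_of_not_dvd hnd, padicValNat.self hp.out.one_lt,
      zero_add]
  -- `ord_p(log_p q) = d ≥ 1`
  obtain ⟨k', u, hqu⟩ := exists_eq_prime_pow_mul_units_of_norm_lt_one Dq.q_ne_zero Dq.norm_q_lt_one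
  obtain ⟨d, hd1, -, hval⟩ := exists_depth_of_padicLog_odd hp2 hqu hlog
  obtain ⟨w, rfl⟩ : ∃ w : ℕ, d = w + 1 := ⟨d - 1, by omega⟩
  have hw : (padicLog p Dq.q).valuation = (w : ℤ) + 1 := by rw [hval]; push_cast; ring
  refine ⟨w, by rw [h2p, hw]; push_cast; ring, fun n ↦ ?_⟩
  exact finite_and_natCard_localTowerKerPrimary_eq_pow_splitOdd hp2 W Dq hlog hw κ hκ v hv n

/-! ### The named fact, all primes -/

/-- **Greenberg, LNM 1716 §3 (PDF pp. 90–93), the local tower kernel at a SPLIT multiplicative prime over the tower of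
`ℚ` — the PRINT named fact `Greenberg1999.sec3_natCard_localTowerKerPrimary_splitMultiplicative_rat` DISCHARGED**: for
`W/ℚ` globally minimal elliptic with a Tate parameter datum at `p`, `log_p q_E ≠ 0`, the cyclotomic `κ` and `v ∋ p`, there is
`e` with `e + ord_p(2p) = ord_p(log_p q_E)` such that at every layer `𝒦_{v,n}[p^∞]` is finite of order `p^e`. `p = 2`: part 3
(`sec3_natCard_localTowerKerPrimary_splitMultiplicative_two`); odd `p`: `sec3_natCard_localTowerKerPrimary_splitMultiplicative_odd`.
[cite: GreenbergLNM1716, §3, between Prop. 3.6 and Prop. 3.7 (PDF pp. 90–93)] [cite: Washington1997, §13.1] -/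
theorem sec3_natCard_localTowerKerPrimary_splitMultiplicative_rat_holds :
    Greenberg1999.sec3_natCard_localTowerKerPrimary_splitMultiplicative_rat := by
  intro W _ _ p _ Dq hlog κ hκ v hv
  by_cases hp2 : p = 2
  · subst hp2
    exact sec3_natCard_localTowerKerPrimary_splitMultiplicative_two W Dq hlog κ hκ v hv
  · exact sec3_natCard_localTowerKerPrimary_splitMultiplicative_odd hp2 W Dq hlog κ hκ v hv

end Summit.BirchSwinnertonDyer.BirchSwinnertonDyer.Theorems.MultTowerSplitExact

end
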